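import Summits.CriticalPhenomena.PercolationContinuityZ3.Theorems.PercNearOneGluingNoHeavyLowerTailKNGoodB3TwoWorld
import Literature.Probability.Percolation.KozmaNitzanGoodQuadruple
import HarnessLib

/-!
# `NoHeavyLowerTail` (stmt-CriticalPhenomena-4575) — universal goodness at `|A| = 3`, B-side: CELLS, POCKETS AND WORLDS
# of a separated quadruple with three relays

Support file (`--supports stmt-CriticalPhenomena-4575`, hull-port prover `prim-hp-2`, gen 21).  No named facts, no sorries;
standard axioms.  For `S : KNSep.SepData` (Literature `KozmaNitzanSeparatingTriple.lean`):

* `KNGoodB3.Afin S = {a₁,a₂,a₃}` as a `Finset`; `KNGoodB3.clPred S W` (the `B`-predicate "`C_B(o) = W`");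
  `KNGoodB3.pk S Φ W = μ(C(o) = W, Φ)` — the mass of the pocket `W` (Kozma–Nitzan's `{C(0) = W}`, `clusterIs`) in the `B`-cell `Φ`.
* `openCluster_eq_rb`, `clusterIs_inter_sureSet` — for `W ∩ A = ∅` the pocket event IS a `B`-event (amalgamation along `A`);
  `real_conn_inter_pocket`, **`pocket_decomp`**: `μ(C(o)=W, x↔b) = Σ_σ μ(C(o)=W, σ) · q^{(σ)}_x` over the five worlds
  (the pocket version of `SepData.conn_decomp`).
* `real_ev_notConn`, `real_ev_split_oA`, **`QM_split`, `Q12_split`, `Q13_split`, `Q23_split`** — each world is partitioned by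
  the type of the observer (its `B`-block, or a hairless pocket); `worlds_degenerate` — if `d` is null then two glued worlds
  are null (`SepData.m_zero_cases`).
[cite: KozmaNitzan2024, §3.2 (p. 12), proof of Thm. 3 (pp. 10–12)]
-/

noncomputable section

namespace Summit.CriticalPhenomena.PercolationContinuityZ3.Theorems

open MeasureTheory Set Literature.Probability.LatticeModels Literature.Probability.Percolation
open scoped Classical

namespace KNGoodB3

open KNSep KNGoodAux KNGoodPocketBHK

variable {V : Type*} [Fintype V] (S : SepData V)

/-- The relay set as a `Finset`. [cite: KozmaNitzan2024, Thm. 3 (p. 10)] -/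
def Afin : Finset V := {S.a₁, S.a₂, S.a₃}

omit [Fintype V] in
/-- `↑Afin = A`. [folklore] -/
theorem coe_Afin : (↑(Afin S) : Set V) = S.A := by
  simp only [Afin, SepData.A, Finset.coe_insert, Finset.coe_singleton]

omit [Fintype V] in
/-- `Afin` is nonempty. [folklore] -/
theorem Afin_nonempty : (Afin S).Nonempty := ⟨S.a₁, by simp [Afin]⟩

omit [Fintype V] in
/-- Members of `Afin`. [folklore] -/
theorem mem_Afin {a : V} : a ∈ Afin S ↔ a = S.a₁ ∨ a = S.a₂ ∨ a = S.a₃ := by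
  simp only [Afin, Finset.mem_insert, Finset.mem_singleton]

/-- `B`-predicate "the `B`-cluster of `o` is exactly `W`". [cite: KozmaNitzan2024, §3.2 (p. 12)] -/
def clPred (W : Finset V) (r : V → V → Prop) : Prop := ∀ v, r S.o v ↔ v ∈ W

/-- The mass of the pocket `W` inside the `B`-cell `Φ`: `μ(C(o) = W, Φ)`. [cite: KozmaNitzan2024, §3.2 (p. 12)] -/
def pk (Φ : (V → V → Prop) → Prop) (W : Finset V) : ℝ := (prodBernoulli S.w).real (clusterIs S.o W ∩ S.ev Φ)

omit [Fintype V] in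
/-- Pocket masses are nonnegative. [folklore] -/
theorem pk_nonneg (Φ : (V → V → Prop) → Prop) (W : Finset V) : 0 ≤ pk S Φ W := measureReal_nonneg

omit [Fintype V] in
/-- **When `o` is `B`-joined to no relay, its cluster is its `B`-cluster** (no open cross pairs).
[cite: KozmaNitzan2024, proof of Thm. 3 (pp. 10–11)] -/
theorem openCluster_eq_rb {ω : BondConfig V} (hω : noCross S.VB S.A ω) (hno : ∀ a ∈ S.A, ¬ S.rb ω S.o a) :
    openCluster ω S.o = {v | S.rb ω S.o v} := by
  ext v
  refine ⟨fun hv => ?_, fun hv => rB.reachable hv⟩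
  have hv' : (openGraph ω).Reachable S.o v := hv
  by_cases hvB : v ∈ S.VB
  · rcases (amalgam hω hv').2.2.2 S.ho hvB with h | ⟨a, ha, -, -, hoa, -⟩
    · exact h
    · exact absurd hoa (hno a ha)
  · obtain ⟨a, ha, hoa, -⟩ := (amalgam hω hv').2.2.1 S.ho hvB
    exact absurd hoa (hno a ha)

omit [Fintype V] in
/-- **The pocket events are `B`-events**: on the sure set, `{C(o) = W} = ev(clPred W)` for `W ∩ A = ∅`.
[cite: KozmaNitzan2024, §3.2 (p. 12)] -/
theorem clusterIs_inter_sureSet {W : Finset V} (hW : Disjoint (↑W : Set V) S.A) :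
    clusterIs S.o W ∩ sureSet S.w = S.ev (clPred S W) ∩ sureSet S.w := by
  ext ω
  simp only [Set.mem_inter_iff, mem_clusterIs, SepData.mem_ev, clPred]
  constructor
  · rintro ⟨hC, hs⟩
    have hω := S.sureSet_subset_noCross hs
    have hno : ∀ a ∈ S.A, ¬ S.rb ω S.o a := fun a ha hoa =>
      Set.disjoint_left.1 hW (show a ∈ (↑W : Set V) from hC ▸ (rB.reachable hoa : a ∈ openCluster ω S.o)) ha
    refine ⟨fun v => ?_, hs⟩
    rw [← Finset.mem_coe, ← hC, openCluster_eq_rb S hω hno]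
    rfl
  · rintro ⟨hP, hs⟩
    have hω := S.sureSet_subset_noCross hs
    have hno : ∀ a ∈ S.A, ¬ S.rb ω S.o a := fun a ha hoa =>
      Set.disjoint_left.1 hW (Finset.mem_coe.2 ((hP a).1 hoa)) ha
    refine ⟨?_, hs⟩
    rw [openCluster_eq_rb S hω hno]
    ext v
    simp only [Set.mem_setOf_eq, Finset.mem_coe, hP v]

/-- Pocket masses as masses of `B`-events. [folklore] -/
theorem pk_eq_ev (Φ : (V → V → Prop) → Prop) {W : Finset V} (hW : Disjoint (↑W : Set V) S.A) :
    pk S Φ W = (prodBernoulli S.w).real (S.ev fun r => Φ r ∧ clPred S W r) := by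
  refine real_eq_of_inter_sureSet S.w ?_
  have h := clusterIs_inter_sureSet S hW
  ext ω
  constructor
  · rintro ⟨⟨hC, hΦ⟩, hs⟩
    have : ω ∈ S.ev (clPred S W) ∩ sureSet S.w := h ▸ ⟨hC, hs⟩
    exact ⟨⟨hΦ, this.1⟩, hs⟩
  · rintro ⟨⟨hΦ, hP⟩, hs⟩
    have : ω ∈ clusterIs S.o W ∩ sureSet S.w := h.symm ▸ ⟨hP, hs⟩
    exact ⟨⟨this.1, hΦ⟩, hs⟩

/-- **Product formula for a pocket cell**: `μ(x ↔ b, C(o) = W, Φ) = μ(C(o) = W, Φ) · q^{(F)}_x` if the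
`B`-cell `Φ` forces the glue set `F` (`x` off the `B`-interior, `W ∩ A = ∅`).
[cite: KozmaNitzan2024, proof of Thm. 3 (pp. 10–11)] -/
theorem real_conn_inter_pocket {x : V} (hx : x ∉ S.VB) (Φ : (V → V → Prop) → Prop) (F : Set (Sym2 V))
    (hF : ∀ ω, Φ (S.rb ω) → glueSet S.VB S.A ω = F) {W : Finset V} (hW : Disjoint (↑W : Set V) S.A) :
    (prodBernoulli S.w).real (openConn x S.b ∩ (clusterIs S.o W ∩ S.ev Φ)) = pk S Φ W * S.Q F x := by
  rw [pk_eq_ev S Φ hW]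
  have e1 : (prodBernoulli S.w).real (openConn x S.b ∩ (clusterIs S.o W ∩ S.ev Φ)) =
      (prodBernoulli S.w).real (openConn x S.b ∩ S.ev fun r => Φ r ∧ clPred S W r) := by
    refine real_eq_of_inter_sureSet S.w ?_
    have h := clusterIs_inter_sureSet S hW
    ext ω
    constructor
    · rintro ⟨⟨hxb, hC, hΦ⟩, hs⟩
      have : ω ∈ S.ev (clPred S W) ∩ sureSet S.w := h ▸ ⟨hC, hs⟩
      exact ⟨⟨hxb, hΦ, this.1⟩, hs⟩
    · rintro ⟨⟨hxb, hΦ, hP⟩, hs⟩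
      have : ω ∈ clusterIs S.o W ∩ sureSet S.w := h.symm ▸ ⟨hP, hs⟩
      exact ⟨⟨hxb, this.1, hΦ⟩, hs⟩
  rw [e1]
  exact S.real_conn_inter_ev hx (fun r => Φ r ∧ clPred S W r) F fun ω h => hF ω h.1

/-- **The pocket gap expansion**: `μ(C(o) = W, x ↔ b) = Σ_σ μ(C(o) = W, σ) · q^{(σ)}_x` over the five worlds.
[cite: KozmaNitzan2024, proof of Thm. 3 (pp. 10–11), §3.2 (p. 12)] -/
theorem pocket_decomp {x : V} (hx : x ∉ S.VB) {W : Finset V} (hW : Disjoint (↑W : Set V) S.A) :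
    (prodBernoulli S.w).real (clusterIs S.o W ∩ openConn x S.b) =
      pk S S.c123 W * S.Q S.F123 x + pk S S.c12 W * S.Q S.F12 x + pk S S.c13 W * S.Q S.F13 x +
      pk S S.c23 W * S.Q S.F23 x + pk S S.cM W * S.Q ∅ x := by
  have hin : ∀ Φ : (V → V → Prop) → Prop, clusterIs S.o W ∩ openConn x S.b ∩ S.ev Φ =
      openConn x S.b ∩ (clusterIs S.o W ∩ S.ev Φ) := by
    intro Φ; ext ω; simp only [Set.mem_inter_iff]; tauto
  rw [S.five_split' (clusterIs S.o W ∩ openConn x S.b), hin, hin, hin, hin, hin,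
    real_conn_inter_pocket S hx _ _ S.glue_c123 hW, real_conn_inter_pocket S hx _ _ S.glue_c12 hW,
    real_conn_inter_pocket S hx _ _ S.glue_c13 hW, real_conn_inter_pocket S hx _ _ S.glue_c23 hW,
    real_conn_inter_pocket S hx _ _ S.glue_cM hW]

/-! #### Partition of a world by the type of the observer -/

/-- The part of a `B`-cell where `o` misses `A` is the sum of its pockets. [cite: KozmaNitzan2024, §3.2 (p. 12)] -/
theorem real_ev_notConn (Φ : (V → V → Prop) → Prop) :
    (prodBernoulli S.w).real (S.ev fun r => Φ r ∧ ∀ a ∈ S.A, ¬ r S.o a) = ∑ W ∈ nullSets (Afin S), pk S Φ W := by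
  classical
  simp only [pk]
  rw [sum_real_clusterIs_inter S.w (Afin S) S.o (S.ev Φ)]
  refine real_eq_of_inter_sureSet S.w ?_
  ext ω
  simp only [Set.mem_inter_iff, SepData.mem_ev, Set.mem_setOf_eq, mem_Afin]
  constructor
  · rintro ⟨⟨hΦ, hno⟩, hs⟩
    have hω := S.sureSet_subset_noCross hs
    refine ⟨⟨fun a ha h => ?_, hΦ⟩, hs⟩
    have haA : a ∈ S.A := by rcases ha with rfl | rfl | rfl <;> simp [SepData.A]
    obtain ⟨a', ha', hoa'⟩ := (S.reachable_oA_iff hω).1 ⟨a, haA, h⟩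
    exact hno a' ha' hoa'
  · rintro ⟨⟨hno, hΦ⟩, hs⟩
    refine ⟨⟨hΦ, fun a ha hoa => ?_⟩, hs⟩
    have : a = S.a₁ ∨ a = S.a₂ ∨ a = S.a₃ := by simpa [SepData.A] using ha
    exact hno a this (rB.reachable hoa)

/-- Splitting a `B`-cell by whether `o` reaches `A` in `B`. [folklore] -/
theorem real_ev_split_oA (Φ : (V → V → Prop) → Prop) :
    (prodBernoulli S.w).real (S.ev Φ) =
      (prodBernoulli S.w).real (S.ev fun r => Φ r ∧ (r S.o S.a₁ ∨ r S.o S.a₂ ∨ r S.o S.a₃)) +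
        ∑ W ∈ nullSets (Afin S), pk S Φ W := by
  rw [← real_ev_notConn S Φ]
  have h := S.real_split_ev Set.univ Φ (fun r => r S.o S.a₁ ∨ r S.o S.a₂ ∨ r S.o S.a₃)
  simp only [Set.univ_inter] at h
  rw [h]
  congr 2
  ext ω
  simp only [SepData.mem_ev, SepData.A, Set.mem_insert_iff, Set.mem_singleton_iff, forall_eq_or_imp, forall_eq,
    not_or]

/-- **World `d` by observer type**: `μ(d) = μ(d, o~a₁) + μ(d, o~a₂) + μ(d, o~a₃) + Σ_W μ(C(o)=W, d)`.
[cite: KozmaNitzan2024, proof of Thm. 3 (p. 11)] -/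
theorem QM_split :
    (prodBernoulli S.w).real (S.ev S.cM) =
      (prodBernoulli S.w).real (S.ev fun r => S.cM r ∧ r S.o S.a₁) +
      (prodBernoulli S.w).real (S.ev fun r => S.cM r ∧ r S.o S.a₂) +
      (prodBernoulli S.w).real (S.ev fun r => S.cM r ∧ r S.o S.a₃) + ∑ W ∈ nullSets (Afin S), pk S S.cM W := by
  rw [real_ev_split_oA S S.cM]
  have h1 := S.real_split_ev Set.univ (fun r => S.cM r ∧ (r S.o S.a₁ ∨ r S.o S.a₂ ∨ r S.o S.a₃)) (fun r => r S.o S.a₁)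
  have h2 := S.real_split_ev Set.univ
    (fun r => (S.cM r ∧ (r S.o S.a₁ ∨ r S.o S.a₂ ∨ r S.o S.a₃)) ∧ ¬ r S.o S.a₁) (fun r => r S.o S.a₂)
  simp only [Set.univ_inter] at h1 h2
  have e1 : S.ev (fun r => (S.cM r ∧ (r S.o S.a₁ ∨ r S.o S.a₂ ∨ r S.o S.a₃)) ∧ r S.o S.a₁) =
      S.ev fun r => S.cM r ∧ r S.o S.a₁ := by
    ext ω; simp only [SepData.mem_ev]; tauto
  have e2 : S.ev (fun r => ((S.cM r ∧ (r S.o S.a₁ ∨ r S.o S.a₂ ∨ r S.o S.a₃)) ∧ ¬ r S.o S.a₁) ∧ r S.o S.a₂) =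
      S.ev fun r => S.cM r ∧ r S.o S.a₂ := by
    ext ω; simp only [SepData.mem_ev, SepData.cM]
    constructor
    · rintro ⟨⟨⟨h, -⟩, -⟩, h2⟩; exact ⟨h, h2⟩
    · rintro ⟨h, h2⟩; exact ⟨⟨⟨h, Or.inr (Or.inl h2)⟩, fun h1 => h.1 (rB.trans (rB.symm h1) h2)⟩, h2⟩
  have e3 : S.ev (fun r => ((S.cM r ∧ (r S.o S.a₁ ∨ r S.o S.a₂ ∨ r S.o S.a₃)) ∧ ¬ r S.o S.a₁) ∧ ¬ r S.o S.a₂) =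
      S.ev fun r => S.cM r ∧ r S.o S.a₃ := by
    ext ω; simp only [SepData.mem_ev, SepData.cM]
    constructor
    · rintro ⟨⟨⟨h, h1 | h2 | h3⟩, hn1⟩, hn2⟩
      · exact absurd h1 hn1
      · exact absurd h2 hn2
      · exact ⟨h, h3⟩
    · rintro ⟨h, h3⟩
      exact ⟨⟨⟨h, Or.inr (Or.inr h3)⟩, fun h1 => h.2.1 (rB.trans (rB.symm h1) h3)⟩,
        fun h2 => h.2.2 (rB.trans (rB.symm h2) h3)⟩
  rw [h1, e1, h2, e2, e3]
  ring

/-- **World `[12]` by observer type**: `μ([12]) = μ([12], o~a₁) + μ([12], o~a₃) + Σ_W μ(C(o)=W, [12])`.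
[cite: KozmaNitzan2024, proof of Thm. 3 (p. 11)] -/
theorem Q12_split :
    (prodBernoulli S.w).real (S.ev S.c12) =
      (prodBernoulli S.w).real (S.ev fun r => S.c12 r ∧ r S.o S.a₁) +
      (prodBernoulli S.w).real (S.ev fun r => S.c12 r ∧ r S.o S.a₃) + ∑ W ∈ nullSets (Afin S), pk S S.c12 W := by
  rw [real_ev_split_oA S S.c12]
  have h1 := S.real_split_ev Set.univ (fun r => S.c12 r ∧ (r S.o S.a₁ ∨ r S.o S.a₂ ∨ r S.o S.a₃)) (fun r => r S.o S.a₁)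
  simp only [Set.univ_inter] at h1
  have e1 : S.ev (fun r => (S.c12 r ∧ (r S.o S.a₁ ∨ r S.o S.a₂ ∨ r S.o S.a₃)) ∧ r S.o S.a₁) =
      S.ev fun r => S.c12 r ∧ r S.o S.a₁ := by
    ext ω; simp only [SepData.mem_ev]; tauto
  have e2 : S.ev (fun r => (S.c12 r ∧ (r S.o S.a₁ ∨ r S.o S.a₂ ∨ r S.o S.a₃)) ∧ ¬ r S.o S.a₁) =
      S.ev fun r => S.c12 r ∧ r S.o S.a₃ := by
    ext ω; simp only [SepData.mem_ev, SepData.c12]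
    constructor
    · rintro ⟨⟨h, h1 | h2 | h3⟩, hn1⟩
      · exact absurd h1 hn1
      · exact absurd (rB.trans h2 (rB.symm h.1)) hn1
      · exact ⟨h, h3⟩
    · rintro ⟨h, h3⟩
      exact ⟨⟨h, Or.inr (Or.inr h3)⟩, fun h1 => h.2 (rB.trans (rB.symm h1) h3)⟩
  rw [h1, e1, e2]

/-- **World `[13]` by observer type**: `μ([13]) = μ([13], o~a₁) + μ([13], o~a₂) + Σ_W μ(C(o)=W, [13])`.
[cite: KozmaNitzan2024, proof of Thm. 3 (p. 11)] -/
theorem Q13_split :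
    (prodBernoulli S.w).real (S.ev S.c13) =
      (prodBernoulli S.w).real (S.ev fun r => S.c13 r ∧ r S.o S.a₁) +
      (prodBernoulli S.w).real (S.ev fun r => S.c13 r ∧ r S.o S.a₂) + ∑ W ∈ nullSets (Afin S), pk S S.c13 W := by
  rw [real_ev_split_oA S S.c13]
  have h1 := S.real_split_ev Set.univ (fun r => S.c13 r ∧ (r S.o S.a₁ ∨ r S.o S.a₂ ∨ r S.o S.a₃)) (fun r => r S.o S.a₁)
  simp only [Set.univ_inter] at h1
  have e1 : S.ev (fun r => (S.c13 r ∧ (r S.o S.a₁ ∨ r S.o S.a₂ ∨ r S.o S.a₃)) ∧ r S.o S.a₁) =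
      S.ev fun r => S.c13 r ∧ r S.o S.a₁ := by
    ext ω; simp only [SepData.mem_ev]; tauto
  have e2 : S.ev (fun r => (S.c13 r ∧ (r S.o S.a₁ ∨ r S.o S.a₂ ∨ r S.o S.a₃)) ∧ ¬ r S.o S.a₁) =
      S.ev fun r => S.c13 r ∧ r S.o S.a₂ := by
    ext ω; simp only [SepData.mem_ev, SepData.c13]
    constructor
    · rintro ⟨⟨h, h1 | h2 | h3⟩, hn1⟩
      · exact absurd h1 hn1
      · exact ⟨h, h2⟩
      · exact absurd (rB.trans h3 (rB.symm h.2)) hn1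
    · rintro ⟨h, h2⟩
      exact ⟨⟨h, Or.inr (Or.inl h2)⟩, fun h1 => h.1 (rB.trans (rB.symm h1) h2)⟩
  rw [h1, e1, e2]

/-- **World `[23]` by observer type**: `μ([23]) = μ([23], o~a₁) + μ([23], o~a₂) + Σ_W μ(C(o)=W, [23])`.
[cite: KozmaNitzan2024, proof of Thm. 3 (p. 11)] -/
theorem Q23_split :
    (prodBernoulli S.w).real (S.ev S.c23) =
      (prodBernoulli S.w).real (S.ev fun r => S.c23 r ∧ r S.o S.a₁) +
      (prodBernoulli S.w).real (S.ev fun r => S.c23 r ∧ r S.o S.a₂) + ∑ W ∈ nullSets (Afin S), pk S S.c23 W := by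
  rw [real_ev_split_oA S S.c23]
  have h1 := S.real_split_ev Set.univ (fun r => S.c23 r ∧ (r S.o S.a₁ ∨ r S.o S.a₂ ∨ r S.o S.a₃)) (fun r => r S.o S.a₁)
  simp only [Set.univ_inter] at h1
  have e1 : S.ev (fun r => (S.c23 r ∧ (r S.o S.a₁ ∨ r S.o S.a₂ ∨ r S.o S.a₃)) ∧ r S.o S.a₁) =
      S.ev fun r => S.c23 r ∧ r S.o S.a₁ := by
    ext ω; simp only [SepData.mem_ev]; tauto
  have e2 : S.ev (fun r => (S.c23 r ∧ (r S.o S.a₁ ∨ r S.o S.a₂ ∨ r S.o S.a₃)) ∧ ¬ r S.o S.a₁) =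
      S.ev fun r => S.c23 r ∧ r S.o S.a₂ := by
    ext ω; simp only [SepData.mem_ev, SepData.c23]
    constructor
    · rintro ⟨⟨h, h1 | h2 | h3⟩, hn1⟩
      · exact absurd h1 hn1
      · exact ⟨h, h2⟩
      · exact ⟨h, rB.trans h3 (rB.symm h.2.2)⟩
    · rintro ⟨h, h2⟩
      exact ⟨⟨h, Or.inr (Or.inl h2)⟩, fun h1 => h.1 (rB.trans (rB.symm h1) h2)⟩
  rw [h1, e1, e2]

/-- **Degenerate worlds**: if `d` is null then two of the glued worlds are null.
[cite: KozmaNitzan2024, proof of Thm. 3 (pp. 11–12)] -/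
theorem worlds_degenerate (hM : (prodBernoulli S.w).real (S.ev S.cM) = 0) :
    ((prodBernoulli S.w).real (S.ev S.c12) = 0 ∧ (prodBernoulli S.w).real (S.ev S.c13) = 0) ∨
    ((prodBernoulli S.w).real (S.ev S.c12) = 0 ∧ (prodBernoulli S.w).real (S.ev S.c23) = 0) ∨
    ((prodBernoulli S.w).real (S.ev S.c13) = 0 ∧ (prodBernoulli S.w).real (S.ev S.c23) = 0) := by
  have sub : ∀ (Φ Ψ : (V → V → Prop) → Prop), (∀ ω, Φ (S.rb ω) → Ψ (S.rb ω)) →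
      (prodBernoulli S.w).real (S.ev Ψ) = 0 → (prodBernoulli S.w).real (S.ev Φ) = 0 := fun Φ Ψ h h0 =>
    le_antisymm (h0 ▸ measureReal_mono (fun ω hω => h ω hω)) measureReal_nonneg
  rcases S.m_zero_cases hM with h12 | h13 | h23
  · exact Or.inr (Or.inr ⟨sub _ _ (fun ω h => h.1) h12, sub _ _ (fun ω h => h.1) h12⟩)
  · exact Or.inr (Or.inl ⟨sub _ _ (fun ω h => h.2) h13, sub _ _ (fun ω h => h.2.1) h13⟩)
  · refine Or.inl ⟨sub _ _ (fun ω h h23' => h.2 (rB.trans h.1 h23')) h23, sub _ _ (fun ω h h23' => ?_) h23⟩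
    exact h.1 (rB.trans h.2 (rB.symm h23'))

end KNGoodB3

end Summit.CriticalPhenomena.PercolationContinuityZ3.Theorems
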